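import Literature.Probability.LatticeModels.KernelTreeDecay
import Mathlib.Algebra.Order.BigOperators.Group.Finset
import HarnessLib

/-!
# The tree-decay lemma with ORIENTED lines and sector levels (BGM 2006, App. A4, (A4.8))

Topic `Literature/Probability/LatticeModels`; companion of `KernelTreeDecay.lean` (`sum_kernelProd_lineProd_le`: peeling the
leaves of a script of extended vertices, every vertex estimated by its anchored `L¹` norm with ONE slot pinned — the slot through
which the spanning tree enters it).  In the sectorised bookkeeping of Benfatto–Giuliani–Mastropietro (Ann. Henri Poincaré 7
(2006), §2.8 and App. A4) the labels carry a SECTOR (`sec : Λ → Σ`), a vertex kernel summed with `F` of its slots of known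
sector is smaller the larger `F` (its "level"), and a tree line between a parent slot and a child slot can be read in TWO ways
((A4.8), the `sup / Σ` exchange `Σ_{x,σ} f(x,σ) h(σ,·) ≤ [sup_σ Σ_x f(x,σ)] · [Σ_σ …]`):

* standard — the child is pinned at its entering slot (full label: one more known sector for the CHILD), the line's row sum
  `≤ Γ` is spent on the parent side;
* swapped — the parent's line slot is restricted to a sector `σ` and `σ` is summed at the very end (one more known sector for
  the PARENT), the child is only asked with its entering slot pinned "in position", its sector summed (`hKsw`), and the line
  costs `c · Γ`, `c` = the maximal number of sectors `σ` talking to a given sector `σ'` (`ov σ σ'`; `c = 27` at (A4.8)).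

`sum_restrictK_prod_lineProd_le_oriented` is the resulting bound for an arbitrary orientation `o` (per non-root point: the
reading of its entering line) and an arbitrary initial partial sector assignment `ρ` (the externally prescribed slots): the
level of a vertex is `#{restricted slots} + #{swapped child lines} + [root, or entered by a standard line]` — the count
`fixedCount` of `FermiRG.BGM2006Routing` — and the constant is `(c Γ)^k`.

* `restrictK` — a kernel restricted by a partial sector assignment on its slots; `levR` — the number of restricted slots;
  `swCount` — the number of swapped lines entering the slots of a vertex;
* `sum_restrictK_prod_lineProd_le_oriented` — the oriented tree-decay lemma.

Everything is proved; no named fact.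

## Sources

G. Benfatto, A. Giuliani, V. Mastropietro, Ann. Henri Poincaré 7 (2006) 809–898, §2.8 (2.97)–(2.98), App. A4 (A4.5)–(A4.8)
(`BenfattoGiulianiMastropietro2006`); the unoriented lemma: proof of (2.77) there and K. Gawȩdzki, A. Kupiainen, Comm. Math.
Phys. 102 (1985) 1–30, §3.
-/

noncomputable section

open Finset

namespace Literature.Probability.LatticeModels

namespace BattleFederbush

variable {ι : Type*} {v : ι} {S : Type*} {Λ : Type*} {Sec : Type*}

section Defs

open Classical in
/-- **A vertex kernel restricted by a partial sector assignment** `ρ` on its slots: `K u x` if every slot `τ` of `u` with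
`ρ τ = some σ` carries a label of sector `σ`, and `0` otherwise (BGM 2006, §2.8: the kernel with the sectors of some of its
legs prescribed). [cite: BenfattoGiulianiMastropietro2006, §2.8 (2.97)] -/
def restrictK (cS : S → ι) (sec : Λ → Sec) (ρ : S → Option Sec) (K : ι → (S → Λ) → ℝ) (u : ι) (x : S → Λ) : ℝ :=
  if ∀ τ, cS τ = u → ∀ σ, ρ τ = some σ → sec (x τ) = σ then K u x else 0

/-- **The level of a vertex under a partial sector assignment**: the number of its slots whose sector is prescribed.
[cite: BenfattoGiulianiMastropietro2006, §2.8 (2.98)] -/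
def levR [Fintype S] [DecidableEq ι] [DecidableEq Sec] (cS : S → ι) (ρ : S → Option Sec) (u : ι) : ℕ :=
  (univ.filter fun τ : S => cS τ = u ∧ ρ τ ≠ none).card

/-- **The number of swapped lines of a script entering the slots of a vertex** (`o z = false`: the line entering the point `z`,
at the parent slot `pS z`, is read the swapped way). [cite: BenfattoGiulianiMastropietro2006, App. A4 (A4.8)] -/
def swCount [DecidableEq ι] (cS : S → ι) (pS : ι → S) (o : ι → Bool) {k : ℕ} (s : Script v k) (u : ι) : ℕ :=
  ∑ m : Fin k, if o (s.y m.succ) = false ∧ cS (pS (s.y m.succ)) = u then 1 else 0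

/-- A restricted kernel is nonnegative if the kernel is. [cite: BenfattoGiulianiMastropietro2006, §2.8] -/
theorem restrictK_nonneg (cS : S → ι) (sec : Λ → Sec) (ρ : S → Option Sec) {K : ι → (S → Λ) → ℝ}
    (hK0 : ∀ u x, 0 ≤ K u x) (u : ι) (x : S → Λ) : 0 ≤ restrictK cS sec ρ K u x := by
  unfold restrictK; split_ifs
  · exact hK0 u x
  · exact le_rfl

/-- A restricted kernel is at most the kernel. [cite: BenfattoGiulianiMastropietro2006, §2.8] -/
theorem restrictK_le (cS : S → ι) (sec : Λ → Sec) (ρ : S → Option Sec) {K : ι → (S → Λ) → ℝ}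
    (hK0 : ∀ u x, 0 ≤ K u x) (u : ι) (x : S → Λ) : restrictK cS sec ρ K u x ≤ K u x := by
  unfold restrictK; split_ifs
  · exact le_rfl
  · exact hK0 u x

/-- A restricted kernel depends only on the labels of the slots of its vertex. [cite: BenfattoGiulianiMastropietro2006, §2.8] -/
theorem restrictK_loc (cS : S → ι) (sec : Λ → Sec) (ρ : S → Option Sec) {K : ι → (S → Λ) → ℝ}
    (hKloc : ∀ u x x', (∀ τ, cS τ = u → x τ = x' τ) → K u x = K u x') (u : ι) {x x' : S → Λ}
    (hxx' : ∀ τ, cS τ = u → x τ = x' τ) : restrictK cS sec ρ K u x = restrictK cS sec ρ K u x' := by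
  unfold restrictK
  have hiff : (∀ τ, cS τ = u → ∀ σ, ρ τ = some σ → sec (x τ) = σ) ↔
      (∀ τ, cS τ = u → ∀ σ, ρ τ = some σ → sec (x' τ) = σ) := by
    refine forall_congr' fun τ => forall_congr' fun hτ => ?_
    rw [hxx' τ hτ]
  rw [hKloc u x x' hxx']
  by_cases hx : ∀ τ, cS τ = u → ∀ σ, ρ τ = some σ → sec (x τ) = σ
  · rw [if_pos hx, if_pos (hiff.1 hx)]
  · rw [if_neg hx, if_neg fun h' => hx (hiff.2 h')]

/-- With no prescribed sector the restricted kernel is the kernel. [cite: BenfattoGiulianiMastropietro2006, §2.8] -/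
theorem restrictK_none (cS : S → ι) (sec : Λ → Sec) (K : ι → (S → Λ) → ℝ) (u : ι) (x : S → Λ) :
    restrictK cS sec (fun _ => none) K u x = K u x := by
  unfold restrictK
  rw [if_pos]
  intro τ _ σ h
  exact absurd h (by simp)

/-- Prescribing one more sector at a slot of ANOTHER vertex does not change the restricted kernel.
[cite: BenfattoGiulianiMastropietro2006, §2.8] -/
theorem restrictK_update_of_ne [DecidableEq S] (cS : S → ι) (sec : Λ → Sec) (ρ : S → Option Sec)
    (K : ι → (S → Λ) → ℝ) {τ₁ : S} {σ : Sec} {u : ι} (hu : cS τ₁ ≠ u) (x : S → Λ) :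
    restrictK cS sec (Function.update ρ τ₁ (some σ)) K u x = restrictK cS sec ρ K u x := by
  unfold restrictK
  have hiff : (∀ τ, cS τ = u → ∀ σ', Function.update ρ τ₁ (some σ) τ = some σ' → sec (x τ) = σ') ↔
      (∀ τ, cS τ = u → ∀ σ', ρ τ = some σ' → sec (x τ) = σ') := by
    refine forall_congr' fun τ => forall_congr' fun hτ => ?_
    have hne : τ ≠ τ₁ := by rintro rfl; exact hu hτ
    rw [Function.update_of_ne hne]
  by_cases hx : ∀ τ, cS τ = u → ∀ σ', Function.update ρ τ₁ (some σ) τ = some σ' → sec (x τ) = σ'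
  · rw [if_pos hx, if_pos (hiff.1 hx)]
  · rw [if_neg hx, if_neg fun h' => hx (hiff.2 h')]

/-- Prescribing the sector `σ` at a free slot `τ₁` of the vertex itself multiplies the restricted kernel by the indicator of
`sec (x τ₁) = σ`. [cite: BenfattoGiulianiMastropietro2006, §2.8 (2.97)] -/
theorem restrictK_update_self [DecidableEq S] [DecidableEq Sec] (cS : S → ι) (sec : Λ → Sec) (ρ : S → Option Sec)
    (K : ι → (S → Λ) → ℝ) {τ₁ : S} (hρ : ρ τ₁ = none) (σ : Sec) (x : S → Λ) :
    restrictK cS sec (Function.update ρ τ₁ (some σ)) K (cS τ₁) x =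
      if sec (x τ₁) = σ then restrictK cS sec ρ K (cS τ₁) x else 0 := by
  unfold restrictK
  by_cases hx : sec (x τ₁) = σ
  · rw [if_pos hx]
    have hiff : (∀ τ, cS τ = cS τ₁ → ∀ σ', Function.update ρ τ₁ (some σ) τ = some σ' → sec (x τ) = σ') ↔
        (∀ τ, cS τ = cS τ₁ → ∀ σ', ρ τ = some σ' → sec (x τ) = σ') := by
      refine forall_congr' fun τ => forall_congr' fun _ => ?_
      by_cases hτ : τ = τ₁
      · subst hτ
        rw [Function.update_self, hρ]
        constructor
        · intro _ σ' h; exact absurd h (by simp)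
        · intro _ σ' h
          have : σ = σ' := Option.some_injective _ h
          rw [← this, hx]
      · rw [Function.update_of_ne hτ]
    by_cases hc : ∀ τ, cS τ = cS τ₁ → ∀ σ', Function.update ρ τ₁ (some σ) τ = some σ' → sec (x τ) = σ'
    · rw [if_pos hc, if_pos (hiff.1 hc)]
    · rw [if_neg hc, if_neg fun h' => hc (hiff.2 h')]
  · rw [if_neg hx, if_neg]
    intro h
    exact hx (h τ₁ rfl σ (by rw [Function.update_self]))

/-- Prescribing one more sector at a free slot `τ₁` raises the level of the vertex of `τ₁` by one and no other level.
[cite: BenfattoGiulianiMastropietro2006, §2.8 (2.98)] -/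
theorem levR_update [Fintype S] [DecidableEq S] [DecidableEq ι] [DecidableEq Sec] (cS : S → ι) (ρ : S → Option Sec)
    {τ₁ : S} (hρ : ρ τ₁ = none) (σ : Sec) (u : ι) :
    levR cS (Function.update ρ τ₁ (some σ)) u = levR cS ρ u + if cS τ₁ = u then 1 else 0 := by
  unfold levR
  by_cases hu : cS τ₁ = u
  · rw [if_pos hu]
    have hset : (univ.filter fun τ : S => cS τ = u ∧ Function.update ρ τ₁ (some σ) τ ≠ none) =
        insert τ₁ (univ.filter fun τ : S => cS τ = u ∧ ρ τ ≠ none) := by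
      ext τ
      simp only [mem_filter, mem_univ, true_and, mem_insert]
      by_cases hτ : τ = τ₁
      · subst hτ
        simp [hu]
      · rw [Function.update_of_ne hτ]
        simp [hτ]
    rw [hset, card_insert_of_notMem]
    simp [hρ]
  · rw [if_neg hu, add_zero]
    congr 1
    ext τ
    simp only [mem_filter, mem_univ, true_and]
    by_cases hτ : τ = τ₁
    · subst hτ
      simp [hu]
    · rw [Function.update_of_ne hτ]

/-- `swCount` of the empty script vanishes. [cite: BenfattoGiulianiMastropietro2006, App. A4] -/
theorem swCount_nil [DecidableEq ι] (cS : S → ι) (pS : ι → S) (o : ι → Bool) (u : ι) :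
    swCount cS pS o (Script.nil : Script v 0) u = 0 := by
  unfold swCount
  exact Fin.sum_univ_zero _

/-- `swCount` of a script with one more point `z`: one more swapped line at the vertex of `pS z` if `o z = false`.
[cite: BenfattoGiulianiMastropietro2006, App. A4 (A4.8)] -/
theorem swCount_snoc [DecidableEq ι] (cS : S → ι) (pS : ι → S) (o : ι → Bool) {k : ℕ} (s : Script v k)
    (i : Fin (k + 1)) (z : ι) (u : ι) : swCount cS pS o (Script.snoc s i z) u =
      swCount cS pS o s u + if o z = false ∧ cS (pS z) = u then 1 else 0 := by
  unfold swCount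
  rw [Fin.sum_univ_castSucc]
  have hlast : (Script.snoc s i z).y (Fin.last k).succ = z := by
    rw [Fin.succ_last, Script.y_snoc_last]
  have hcast : ∀ m : Fin k, (Script.snoc s i z).y m.castSucc.succ = s.y m.succ := fun m => by
    rw [Fin.succ_castSucc, Script.y_snoc_castSucc]
  simp only [hlast, hcast]

end Defs

section Oriented

variable [DecidableEq ι] [Fintype S] [DecidableEq S] [AddCommGroup Λ] [Fintype Λ] [DecidableEq Λ]
variable [Fintype Sec] [DecidableEq Sec]

/-- **The tree-decay lemma with oriented lines and sector levels** (Benfatto–Giuliani–Mastropietro 2006, App. A4, the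
`sup / Σ` exchange (A4.8) along the lines of the spanning tree).  Setting of `sum_kernelProd_lineProd_le`: slots `S` attached
to vertices by `cS`, labels `Λ` with a sector map `sec : Λ → Σ`, a relation `ov` ("sector `σ` talks to sector `σ'`") with at
most `c ≥ 1` partners `σ` for every `σ'`, nonnegative local vertex kernels `K u`, and LEVELLED norms `N u F ≥ 0`: for every
partial sector assignment `ρ` and every pinnable free slot `τ` of `u`, (`hKN`) the `ρ`-restricted kernel summed with `τ`
pinned is `≤ N u (levR ρ u + 1)`, and (`hKsw`) there are `g σ ≥ 0` with `Σ_σ g σ ≤ N u (levR ρ u)` bounding the same sums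
by `g (sec a)` whatever the pinned label `a` of sector `sec a` (the slot pinned "in position only", its sector summed).  The
line entering the non-root point `z` joins the pinnable slot `pS z` of an earlier point to the pinnable slot `eS z` of `z`,
with a two-point weight `h z ≥ 0` of row sums `≤ Γ` supported on talking sectors; `o z` is its reading.  Hypotheses on the
script: `ρ` leaves `τ₀`, the `eS z` and the parent slots `pS z` of swapped lines free, the latter being pairwise distinct and
distinct from `τ₀` and from the `eS z'`.  Then, the root slot `τ₀` pinned and the slots outside the script frozen,
`Σ_x (∏_u restrictK ρ K u x) ∏_z h z (x (pS z)) (x (eS z)) ≤ N v (levR ρ v + swCount v + 1) · (cΓ)^k ·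
∏_{m=1}^{k} N (y m) (levR ρ (y m) + swCount (y m) + [o (y m)])`. [cite: BenfattoGiulianiMastropietro2006, App. A4 (A4.8); §2.8 (2.97)–(2.98)] -/
theorem sum_restrictK_prod_lineProd_le_oriented (cS : S → ι) (Pn : S → Prop) (sec : Λ → Sec)
    (ov : Sec → Sec → Prop) [DecidableRel ov] {c : ℕ} (hc : 1 ≤ c)
    (hov : ∀ σ' : Sec, (univ.filter fun σ : Sec => ov σ σ').card ≤ c)
    (K : ι → (S → Λ) → ℝ) (hK0 : ∀ u x, 0 ≤ K u x)
    (hKloc : ∀ u x x', (∀ τ, cS τ = u → x τ = x' τ) → K u x = K u x')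
    (N : ι → ℕ → ℝ) (hN0 : ∀ u F, 0 ≤ N u F)
    (hKN : ∀ (ρ : S → Option Sec) (u : ι) (τ : S), cS τ = u → Pn τ → ρ τ = none → ∀ a : Λ,
      ∑ x ∈ univ.filter (fun x : S → Λ => x τ = a ∧ ∀ τ', cS τ' ≠ u → x τ' = 0), restrictK cS sec ρ K u x ≤
        N u (levR cS ρ u + 1))
    (hKsw : ∀ (ρ : S → Option Sec) (u : ι) (τ : S), cS τ = u → Pn τ → ρ τ = none → ∃ g : Sec → ℝ,
      (∀ σ, 0 ≤ g σ) ∧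
      (∀ a : Λ, ∑ x ∈ univ.filter (fun x : S → Λ => x τ = a ∧ ∀ τ', cS τ' ≠ u → x τ' = 0),
          restrictK cS sec ρ K u x ≤ g (sec a)) ∧
      ∑ σ, g σ ≤ N u (levR cS ρ u))
    {Γ : ℝ} (hΓ : 0 ≤ Γ) (h : ι → Λ → Λ → ℝ) (hh0 : ∀ z b b', 0 ≤ h z b b')
    (hrow : ∀ z b, ∑ b', h z b b' ≤ Γ) (hhov : ∀ z b b', h z b b' ≠ 0 → ov (sec b) (sec b'))
    (eS pS : ι → S) (o : ι → Bool) :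
    ∀ {k : ℕ} (s : Script v k), s.Valid → ∀ (ρ : S → Option Sec) (τ₀ : S), cS τ₀ = v → Pn τ₀ → ρ τ₀ = none →
      (∀ m : Fin k, cS (eS (s.y m.succ)) = s.y m.succ ∧ Pn (eS (s.y m.succ)) ∧ Pn (pS (s.y m.succ)) ∧
        ρ (eS (s.y m.succ)) = none ∧ ∃ j : Fin (k + 1), (j : ℕ) ≤ (m : ℕ) ∧ cS (pS (s.y m.succ)) = s.y j) →
      (∀ m : Fin k, o (s.y m.succ) = false →
        ρ (pS (s.y m.succ)) = none ∧ pS (s.y m.succ) ≠ τ₀ ∧ (∀ m' : Fin k, pS (s.y m.succ) ≠ eS (s.y m'.succ)) ∧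
        ∀ m' : Fin k, o (s.y m'.succ) = false → pS (s.y m.succ) = pS (s.y m'.succ) → m = m') →
      ∀ a : Λ,
        ∑ x ∈ univ.filter (fun x : S → Λ => x τ₀ = a ∧ ∀ τ, cS τ ∉ univ.image s.y → x τ = 0),
            (∏ u ∈ univ.image s.y, restrictK cS sec ρ K u x) *
              ∏ m : Fin k, h (s.y m.succ) (x (pS (s.y m.succ))) (x (eS (s.y m.succ))) ≤
          N v (levR cS ρ v + swCount cS pS o s v + 1) *
            ((c * Γ) ^ k * ∏ m : Fin k, N (s.y m.succ)
              (levR cS ρ (s.y m.succ) + swCount cS pS o s (s.y m.succ) + if o (s.y m.succ) then 1 else 0))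
  | _, Script.nil, _, ρ, τ₀, hτ₀, hP₀, hρ₀, _, _, a => by
    rw [Script.image_y_nil, pow_zero, one_mul, Fintype.prod_empty, mul_one, swCount_nil, add_zero]
    simp only [prod_singleton, Fintype.prod_empty, mul_one, mem_singleton]
    simpa using hKN ρ v τ₀ hτ₀ hP₀ hρ₀ a
  | k + 1, Script.snoc s i z, hv, ρ, τ₀, hτ₀, hP₀, hρ₀, hpt, hsw, a => by
    classical
    obtain ⟨hs, hz⟩ := hv
    set Q := (univ : Finset (Fin (k + 1))).image s.y with hQ
    have hzQ : z ∉ Q := fun h => by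
      obtain ⟨m, -, hm⟩ := mem_image.1 h; exact hz m hm
    have hvQ : v ∈ Q := mem_image.2 ⟨0, mem_univ _, Script.y_zero s⟩
    have hτ₀Q : cS τ₀ ∈ Q := hτ₀ ▸ hvQ
    -- the points of the longer script
    have hlast : (Script.snoc s i z).y (Fin.last k).succ = z := by
      rw [Fin.succ_last, Script.y_snoc_last]
    have hcast : ∀ m : Fin k, (Script.snoc s i z).y m.castSucc.succ = s.y m.succ := fun m => by
      rw [Fin.succ_castSucc, Script.y_snoc_castSucc]
    have hyc : ∀ (j : Fin (k + 2)) (j' : Fin (k + 1)), (j : ℕ) = (j' : ℕ) → (Script.snoc s i z).y j = s.y j' := by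
      intro j j' hjj'
      have : j = j'.castSucc := Fin.ext (by rw [Fin.val_castSucc]; exact hjj')
      rw [this, Script.y_snoc_castSucc]
    -- data of the new point `z`
    obtain ⟨heSz, hPe, hPp, hρe, j₀, hj₀, hpSj⟩ := hpt (Fin.last k)
    rw [hlast] at heSz hPe hPp hρe hpSj
    have hj₀' : (j₀ : ℕ) ≤ k := by simpa using hj₀
    rw [hyc j₀ ⟨j₀, Nat.lt_succ_of_le hj₀'⟩ rfl] at hpSj
    have hpQ : cS (pS z) ∈ Q := hpSj ▸ mem_image.2 ⟨_, mem_univ _, rfl⟩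
    have hpz : cS (pS z) ≠ z := fun h => hzQ (h ▸ hpQ)
    have hez : cS (eS z) = z := heSz
    -- data of the old points, for assignments agreeing with `ρ` where it matters
    have hpt' : ∀ ρ' : S → Option Sec, (∀ m : Fin k, ρ' (eS (s.y m.succ)) = ρ (eS (s.y m.succ))) →
        ∀ m : Fin k, cS (eS (s.y m.succ)) = s.y m.succ ∧ Pn (eS (s.y m.succ)) ∧ Pn (pS (s.y m.succ)) ∧
          ρ' (eS (s.y m.succ)) = none ∧ ∃ j : Fin (k + 1), (j : ℕ) ≤ (m : ℕ) ∧ cS (pS (s.y m.succ)) = s.y j := by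
      intro ρ' hρ' m
      obtain ⟨h1, h2, h3, h4, j, hj, h5⟩ := hpt m.castSucc
      rw [hcast] at h1 h2 h3 h4 h5
      simp only [Fin.val_castSucc] at hj
      have hjk : (j : ℕ) ≤ k := by have := m.isLt; omega
      rw [hyc j ⟨j, Nat.lt_succ_of_le hjk⟩ rfl] at h5
      exact ⟨h1, h2, h3, (hρ' m).trans h4, ⟨j, Nat.lt_succ_of_le hjk⟩, hj, h5⟩
    have hsw' : ∀ ρ' : S → Option Sec,
        (∀ m : Fin k, o (s.y m.succ) = false → ρ' (pS (s.y m.succ)) = ρ (pS (s.y m.succ))) →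
        ∀ m : Fin k, o (s.y m.succ) = false →
          ρ' (pS (s.y m.succ)) = none ∧ pS (s.y m.succ) ≠ τ₀ ∧ (∀ m' : Fin k, pS (s.y m.succ) ≠ eS (s.y m'.succ)) ∧
          ∀ m' : Fin k, o (s.y m'.succ) = false → pS (s.y m.succ) = pS (s.y m'.succ) → m = m' := by
      intro ρ' hρ' m hm
      obtain ⟨h1, h2, h3, h4⟩ := hsw m.castSucc (by rw [hcast]; exact hm)
      simp only [hcast] at h1 h2 h3 h4
      refine ⟨(hρ' m hm).trans h1, h2, fun m' => ?_, fun m' hm' heq => ?_⟩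
      · have := h3 m'.castSucc; rwa [hcast] at this
      · exact Fin.castSucc_injective _ (h4 m'.castSucc (by rw [hcast]; exact hm') (by rw [hcast]; exact heq))
    -- the old points' parent slots are not slots of `z`
    have hpSold : ∀ m : Fin k, cS (pS (s.y m.succ)) ≠ z := fun m h' => by
      obtain ⟨-, -, -, -, j, -, h5⟩ := hpt' ρ (fun _ => rfl) m
      exact hzQ (h' ▸ h5 ▸ mem_image.2 ⟨j, mem_univ _, rfl⟩)
    have hswz : swCount cS pS o s z = 0 := by
      unfold swCount
      refine sum_eq_zero fun m _ => ?_
      rw [if_neg]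
      rintro ⟨-, h'⟩
      exact hpSold m h'
    have hswc : ∀ u, swCount cS pS o (Script.snoc s i z) u =
        swCount cS pS o s u + if o z = false ∧ cS (pS z) = u then 1 else 0 := swCount_snoc cS pS o s i z
    -- restricted kernels
    have hKρ0 : ∀ (ρ' : S → Option Sec) u x, 0 ≤ restrictK cS sec ρ' K u x := fun ρ' => restrictK_nonneg cS sec ρ' hK0
    have hKρloc : ∀ (ρ' : S → Option Sec) u x x', (∀ τ, cS τ = u → x τ = x' τ) →
        restrictK cS sec ρ' K u x = restrictK cS sec ρ' K u x' := fun ρ' u x x' hx => restrictK_loc cS sec ρ' hKloc u hx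
    have hR0 : ∀ (ρ' : S → Option Sec) (x' : S → Λ), 0 ≤ (∏ u ∈ Q, restrictK cS sec ρ' K u x') *
        ∏ m : Fin k, h (s.y m.succ) (x' (pS (s.y m.succ))) (x' (eS (s.y m.succ))) := fun ρ' x' =>
      mul_nonneg (prod_nonneg fun u _ => hKρ0 ρ' u x') (prod_nonneg fun m _ => hh0 _ _ _)
    -- split off the slots of `z`
    rw [Script.image_y_snoc, sum_filter_insert_eq_sum_sum cS Q hzQ hτ₀Q a]
    -- the summand at `x' + y`
    have hsummand : ∀ x' ∈ univ.filter (fun x : S → Λ => x τ₀ = a ∧ ∀ τ, cS τ ∉ Q → x τ = 0),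
        ∀ y ∈ univ.filter (fun y : S → Λ => ∀ τ, cS τ ≠ z → y τ = 0),
        (∏ u ∈ insert z Q, restrictK cS sec ρ K u (x' + y)) *
            ∏ m : Fin (k + 1), h ((Script.snoc s i z).y m.succ) ((x' + y) (pS ((Script.snoc s i z).y m.succ)))
              ((x' + y) (eS ((Script.snoc s i z).y m.succ))) =
          ((∏ u ∈ Q, restrictK cS sec ρ K u x') *
              ∏ m : Fin k, h (s.y m.succ) (x' (pS (s.y m.succ))) (x' (eS (s.y m.succ)))) *
            (restrictK cS sec ρ K z y * h z (x' (pS z)) (y (eS z))) := by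
      intro x' hx' y hy
      obtain ⟨-, hx0⟩ := (mem_filter.1 hx').2
      have hy0 := (mem_filter.1 hy).2
      have hoff : ∀ τ, cS τ ≠ z → (x' + y) τ = x' τ := fun τ hτ => by
        rw [Pi.add_apply, hy0 τ hτ, add_zero]
      have hon : ∀ τ, cS τ = z → (x' + y) τ = y τ := fun τ hτ => by
        rw [Pi.add_apply, hx0 τ (hτ ▸ hzQ), zero_add]
      have hKQ : ∏ u ∈ Q, restrictK cS sec ρ K u (x' + y) = ∏ u ∈ Q, restrictK cS sec ρ K u x' := by
        refine prod_congr rfl fun u hu => hKρloc ρ u _ _ fun τ hτ => hoff τ ?_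
        rintro rfl; exact hzQ (hτ ▸ hu)
      have hKz : restrictK cS sec ρ K z (x' + y) = restrictK cS sec ρ K z y := hKρloc ρ z _ _ fun τ hτ => hon τ hτ
      have hlines : ∏ m : Fin k, h (s.y m.succ) ((x' + y) (pS (s.y m.succ))) ((x' + y) (eS (s.y m.succ))) =
          ∏ m : Fin k, h (s.y m.succ) (x' (pS (s.y m.succ))) (x' (eS (s.y m.succ))) := by
        refine prod_congr rfl fun m _ => ?_
        obtain ⟨h1, -, -, -, -⟩ := hpt' ρ (fun _ => rfl) m
        rw [hoff _ (hpSold m), hoff _ (by rw [h1]; exact hz m.succ)]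
      rw [prod_insert hzQ, Fin.prod_univ_castSucc]
      simp only [hlast, hcast]
      rw [hKQ, hKz, hlines, hoff _ hpz, hon _ hez]
      ring
    rw [sum_congr rfl fun x' hx' => sum_congr rfl fun y hy => hsummand x' hx' y hy]
    simp_rw [← Finset.mul_sum]
    -- the target's levels
    rw [Fin.prod_univ_castSucc, pow_succ]
    simp only [hlast, hcast]
    -- the two readings of the last line
    cases hoz : o z
    · -- swapped: the parent slot `pS z` is restricted to a sector `σ`, summed at the end
      obtain ⟨hρp, hpτ₀, hpe, hpinj⟩ := hsw (Fin.last k) (by rw [hlast]; exact hoz)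
      simp only [hlast] at hρp hpτ₀ hpe hpinj
      obtain ⟨g, hg0, hgpt, hgsum⟩ := hKsw ρ z (eS z) hez hPe hρe
      -- levels: old points as in the target, computed with `ρσ := ρ[pS z ↦ σ]`
      have hlev : ∀ (σ : Sec) (u : ι) (e : ℕ), levR cS (Function.update ρ (pS z) (some σ)) u + swCount cS pS o s u + e =
          levR cS ρ u + swCount cS pS o (Script.snoc s i z) u + e := by
        intro σ u e
        rw [levR_update cS ρ hρp, hswc]
        simp only [hoz, true_and]
        ring
      -- the common bound `B` of the old points
      set B : ℝ := N v (levR cS ρ v + swCount cS pS o (Script.snoc s i z) v + 1) *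
        ((c * Γ) ^ k * ∏ m : Fin k, N (s.y m.succ) (levR cS ρ (s.y m.succ) +
          swCount cS pS o (Script.snoc s i z) (s.y m.succ) + if o (s.y m.succ) then 1 else 0)) with hB
      have hB0 : 0 ≤ B := mul_nonneg (hN0 _ _) (mul_nonneg (pow_nonneg (mul_nonneg (by exact_mod_cast c.zero_le) hΓ) _)
        (prod_nonneg fun m _ => hN0 _ _))
      -- the induction hypothesis at `ρσ`
      have hIH : ∀ σ : Sec,
          ∑ x' ∈ univ.filter (fun x : S → Λ => x τ₀ = a ∧ ∀ τ, cS τ ∉ Q → x τ = 0),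
            (∏ u ∈ Q, restrictK cS sec (Function.update ρ (pS z) (some σ)) K u x') *
              ∏ m : Fin k, h (s.y m.succ) (x' (pS (s.y m.succ))) (x' (eS (s.y m.succ))) ≤ B := by
        intro σ
        have hρσ0 : Function.update ρ (pS z) (some σ) τ₀ = none := by
          rw [Function.update_of_ne (Ne.symm hpτ₀)]; exact hρ₀
        have hρσe : ∀ m : Fin k, Function.update ρ (pS z) (some σ) (eS (s.y m.succ)) = ρ (eS (s.y m.succ)) := by
          intro m
          have hne := hpe m.castSucc
          rw [hcast] at hne
          exact Function.update_of_ne (Ne.symm hne) _ _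
        have hρσp : ∀ m : Fin k, o (s.y m.succ) = false →
            Function.update ρ (pS z) (some σ) (pS (s.y m.succ)) = ρ (pS (s.y m.succ)) := by
          intro m hm
          refine Function.update_of_ne (fun heq => ?_) _ _
          have := hpinj m.castSucc (by rw [hcast]; exact hm) (by rw [hcast]; exact heq.symm)
          exact (Fin.castSucc_lt_last m).ne' this
        have := sum_restrictK_prod_lineProd_le_oriented cS Pn sec ov hc hov K hK0 hKloc N hN0 hKN hKsw hΓ h hh0
          hrow hhov eS pS o s hs (Function.update ρ (pS z) (some σ)) τ₀ hτ₀ hP₀ hρσ0 (hpt' _ hρσe) (hsw' _ hρσp) a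
        simp only [hlev] at this
        exact this
      -- restricting at `pS z` is an indicator on the old product
      have hRσ : ∀ (σ : Sec) (x' : S → Λ), (∏ u ∈ Q, restrictK cS sec (Function.update ρ (pS z) (some σ)) K u x') =
          if sec (x' (pS z)) = σ then ∏ u ∈ Q, restrictK cS sec ρ K u x' else 0 := by
        intro σ x'
        rw [← mul_prod_erase Q _ hpQ, ← mul_prod_erase Q (fun u => restrictK cS sec ρ K u x') hpQ,
          restrictK_update_self cS sec ρ K hρp σ x']
        have herase : ∏ u ∈ Q.erase (cS (pS z)), restrictK cS sec (Function.update ρ (pS z) (some σ)) K u x' =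
            ∏ u ∈ Q.erase (cS (pS z)), restrictK cS sec ρ K u x' :=
          prod_congr rfl fun u hu => restrictK_update_of_ne cS sec ρ K (Ne.symm (ne_of_mem_erase hu)) x'
        rw [herase]
        split_ifs <;> simp
      -- the talking sectors of `σ'` and the sum over the parent sector
      have hT : ∀ σ' : Sec,
          ∑ x' ∈ univ.filter (fun x : S → Λ => x τ₀ = a ∧ ∀ τ, cS τ ∉ Q → x τ = 0),
            (if ov (sec (x' (pS z))) σ' then (∏ u ∈ Q, restrictK cS sec ρ K u x') *
              ∏ m : Fin k, h (s.y m.succ) (x' (pS (s.y m.succ))) (x' (eS (s.y m.succ))) else 0) ≤ c * B := by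
        intro σ'
        calc ∑ x' ∈ univ.filter (fun x : S → Λ => x τ₀ = a ∧ ∀ τ, cS τ ∉ Q → x τ = 0),
              (if ov (sec (x' (pS z))) σ' then (∏ u ∈ Q, restrictK cS sec ρ K u x') *
                ∏ m : Fin k, h (s.y m.succ) (x' (pS (s.y m.succ))) (x' (eS (s.y m.succ))) else 0)
            = ∑ x' ∈ univ.filter (fun x : S → Λ => x τ₀ = a ∧ ∀ τ, cS τ ∉ Q → x τ = 0),
                ∑ σ ∈ univ.filter (fun σ : Sec => ov σ σ'),
                  (∏ u ∈ Q, restrictK cS sec (Function.update ρ (pS z) (some σ)) K u x') *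
                    ∏ m : Fin k, h (s.y m.succ) (x' (pS (s.y m.succ))) (x' (eS (s.y m.succ))) := by
              refine sum_congr rfl fun x' _ => ?_
              simp_rw [hRσ, ite_mul, zero_mul]
              rw [sum_ite_eq]
              simp only [mem_filter, mem_univ, true_and]
          _ = ∑ σ ∈ univ.filter (fun σ : Sec => ov σ σ'),
                ∑ x' ∈ univ.filter (fun x : S → Λ => x τ₀ = a ∧ ∀ τ, cS τ ∉ Q → x τ = 0),
                  (∏ u ∈ Q, restrictK cS sec (Function.update ρ (pS z) (some σ)) K u x') *
                    ∏ m : Fin k, h (s.y m.succ) (x' (pS (s.y m.succ))) (x' (eS (s.y m.succ))) := sum_comm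
          _ ≤ ∑ σ ∈ univ.filter (fun σ : Sec => ov σ σ'), B := sum_le_sum fun σ _ => hIH σ
          _ ≤ c * B := by
              rw [sum_const, nsmul_eq_mul]
              exact mul_le_mul_of_nonneg_right (by exact_mod_cast hov σ') hB0
      -- the line entering `z`, child side: position-only pin (`hKsw`)
      have hCh : ∀ b' : Λ, ∑ y ∈ univ.filter (fun y : S → Λ => ∀ τ, cS τ ≠ z → y τ = 0),
          (if y (eS z) = b' then restrictK cS sec ρ K z y else 0) ≤ g (sec b') := by
        intro b'
        rw [← sum_filter, filter_filter]
        have hset : univ.filter (fun y : S → Λ => (∀ τ, cS τ ≠ z → y τ = 0) ∧ y (eS z) = b') =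
            univ.filter (fun y : S → Λ => y (eS z) = b' ∧ ∀ τ, cS τ ≠ z → y τ = 0) :=
          filter_congr fun y _ => and_comm
        rw [hset]
        exact hgpt b'
      have hG : ∀ b : Λ, ∑ y ∈ univ.filter (fun y : S → Λ => ∀ τ, cS τ ≠ z → y τ = 0),
          restrictK cS sec ρ K z y * h z b (y (eS z)) ≤ Γ * ∑ σ', (if ov (sec b) σ' then g σ' else 0) := by
        intro b
        have hgov0 : 0 ≤ ∑ σ', (if ov (sec b) σ' then g σ' else 0) :=
          sum_nonneg fun σ' _ => by split_ifs; exacts [hg0 _, le_rfl]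
        have hterm : ∀ b', h z b b' * g (sec b') ≤ h z b b' * ∑ σ', (if ov (sec b) σ' then g σ' else 0) := by
          intro b'
          by_cases hb : h z b b' = 0
          · rw [hb, zero_mul, zero_mul]
          · refine mul_le_mul_of_nonneg_left ?_ (hh0 _ _ _)
            have hovb : ov (sec b) (sec b') := hhov z b b' hb
            have := single_le_sum (f := fun σ' => if ov (sec b) σ' then g σ' else 0)
              (fun σ' _ => by show 0 ≤ (if ov (sec b) σ' then g σ' else 0); split_ifs; exacts [hg0 _, le_rfl])
              (mem_univ (sec b'))
            simpa [hovb] using this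
        calc ∑ y ∈ univ.filter (fun y : S → Λ => ∀ τ, cS τ ≠ z → y τ = 0),
              restrictK cS sec ρ K z y * h z b (y (eS z))
            = ∑ b', h z b b' * ∑ y ∈ univ.filter (fun y : S → Λ => ∀ τ, cS τ ≠ z → y τ = 0),
                (if y (eS z) = b' then restrictK cS sec ρ K z y else 0) := by
              simp_rw [mul_sum, mul_ite, mul_zero]
              rw [sum_comm]
              refine sum_congr rfl fun y _ => ?_
              rw [sum_ite_eq]
              simp [mul_comm]
          _ ≤ ∑ b', h z b b' * g (sec b') := sum_le_sum fun b' _ => mul_le_mul_of_nonneg_left (hCh b') (hh0 _ _ _)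
          _ ≤ ∑ b', h z b b' * ∑ σ', (if ov (sec b) σ' then g σ' else 0) := sum_le_sum fun b' _ => hterm b'
          _ = (∑ b', h z b b') * ∑ σ', (if ov (sec b) σ' then g σ' else 0) := by rw [sum_mul]
          _ ≤ Γ * ∑ σ', (if ov (sec b) σ' then g σ' else 0) := mul_le_mul_of_nonneg_right (hrow z b) hgov0
      -- assemble
      have hzlev : levR cS ρ z + swCount cS pS o (Script.snoc s i z) z = levR cS ρ z := by
        rw [hswc, hswz, if_neg (fun h' => hpz h'.2), add_zero, add_zero]
      calc ∑ x' ∈ univ.filter (fun x : S → Λ => x τ₀ = a ∧ ∀ τ, cS τ ∉ Q → x τ = 0),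
            ((∏ u ∈ Q, restrictK cS sec ρ K u x') *
                ∏ m : Fin k, h (s.y m.succ) (x' (pS (s.y m.succ))) (x' (eS (s.y m.succ)))) *
              ∑ y ∈ univ.filter (fun y : S → Λ => ∀ τ, cS τ ≠ z → y τ = 0),
                restrictK cS sec ρ K z y * h z (x' (pS z)) (y (eS z))
          ≤ ∑ x' ∈ univ.filter (fun x : S → Λ => x τ₀ = a ∧ ∀ τ, cS τ ∉ Q → x τ = 0),
              ((∏ u ∈ Q, restrictK cS sec ρ K u x') *
                  ∏ m : Fin k, h (s.y m.succ) (x' (pS (s.y m.succ))) (x' (eS (s.y m.succ)))) *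
                (Γ * ∑ σ', (if ov (sec (x' (pS z))) σ' then g σ' else 0)) :=
            sum_le_sum fun x' _ => mul_le_mul_of_nonneg_left (hG _) (hR0 ρ x')
        _ = Γ * ∑ σ', g σ' * ∑ x' ∈ univ.filter (fun x : S → Λ => x τ₀ = a ∧ ∀ τ, cS τ ∉ Q → x τ = 0),
              (if ov (sec (x' (pS z))) σ' then (∏ u ∈ Q, restrictK cS sec ρ K u x') *
                ∏ m : Fin k, h (s.y m.succ) (x' (pS (s.y m.succ))) (x' (eS (s.y m.succ))) else 0) := by
            have lhs : ∀ x' : S → Λ, ((∏ u ∈ Q, restrictK cS sec ρ K u x') *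
                  ∏ m : Fin k, h (s.y m.succ) (x' (pS (s.y m.succ))) (x' (eS (s.y m.succ)))) *
                (Γ * ∑ σ', (if ov (sec (x' (pS z))) σ' then g σ' else 0)) =
                ∑ σ', (if ov (sec (x' (pS z))) σ' then Γ * g σ' * ((∏ u ∈ Q, restrictK cS sec ρ K u x') *
                  ∏ m : Fin k, h (s.y m.succ) (x' (pS (s.y m.succ))) (x' (eS (s.y m.succ)))) else 0) := by
              intro x'
              rw [mul_sum, mul_sum]
              refine sum_congr rfl fun σ' _ => ?_
              split_ifs <;> ring
            have rhs : ∀ σ' : Sec, Γ * (g σ' * ∑ x' ∈ univ.filter (fun x : S → Λ => x τ₀ = a ∧ ∀ τ, cS τ ∉ Q → x τ = 0),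
                (if ov (sec (x' (pS z))) σ' then (∏ u ∈ Q, restrictK cS sec ρ K u x') *
                  ∏ m : Fin k, h (s.y m.succ) (x' (pS (s.y m.succ))) (x' (eS (s.y m.succ))) else 0)) =
                ∑ x' ∈ univ.filter (fun x : S → Λ => x τ₀ = a ∧ ∀ τ, cS τ ∉ Q → x τ = 0),
                  (if ov (sec (x' (pS z))) σ' then Γ * g σ' * ((∏ u ∈ Q, restrictK cS sec ρ K u x') *
                    ∏ m : Fin k, h (s.y m.succ) (x' (pS (s.y m.succ))) (x' (eS (s.y m.succ)))) else 0) := by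
              intro σ'
              rw [mul_sum, mul_sum]
              refine sum_congr rfl fun x' _ => ?_
              split_ifs <;> ring
            rw [sum_congr rfl fun x' _ => lhs x', sum_comm, mul_sum]
            exact sum_congr rfl fun σ' _ => (rhs σ').symm
        _ ≤ Γ * ∑ σ', g σ' * (c * B) := by
            refine mul_le_mul_of_nonneg_left (sum_le_sum fun σ' _ => mul_le_mul_of_nonneg_left (hT σ') (hg0 σ')) hΓ
        _ = (c * Γ) * B * ∑ σ', g σ' := by rw [← sum_mul]; ring
        _ ≤ (c * Γ) * B * N z (levR cS ρ z) :=
            mul_le_mul_of_nonneg_left hgsum (mul_nonneg (mul_nonneg (by exact_mod_cast c.zero_le) hΓ) hB0)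
        _ = N v (levR cS ρ v + swCount cS pS o (Script.snoc s i z) v + 1) *
              ((c * Γ) ^ k * (c * Γ) * ((∏ m : Fin k, N (s.y m.succ) (levR cS ρ (s.y m.succ) +
                swCount cS pS o (Script.snoc s i z) (s.y m.succ) + if o (s.y m.succ) then 1 else 0)) *
                N z (levR cS ρ z + swCount cS pS o (Script.snoc s i z) z + if false then 1 else 0))) := by
            rw [hzlev, hB]
            simp only [if_false, add_zero, Bool.false_eq_true]
            ring
    · -- standard: the child `z` is pinned at its entering slot `eS z`
      have hIH := sum_restrictK_prod_lineProd_le_oriented cS Pn sec ov hc hov K hK0 hKloc N hN0 hKN hKsw hΓ h hh0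
        hrow hhov eS pS o s hs ρ τ₀ hτ₀ hP₀ hρ₀ (hpt' ρ fun _ => rfl) (hsw' ρ fun _ _ => rfl) a
      have hinner : ∀ x' : S → Λ, ∑ y ∈ univ.filter (fun y : S → Λ => ∀ τ, cS τ ≠ z → y τ = 0),
          restrictK cS sec ρ K z y * h z (x' (pS z)) (y (eS z)) ≤ Γ * N z (levR cS ρ z + 1) := fun x' =>
        sum_kernel_mul_twoPoint_le cS (restrictK cS sec ρ K z) (hKρ0 ρ z) (hKN ρ z (eS z) hez hPe hρe)
          (h z (x' (pS z))) (hh0 z _) (hrow z _)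
      have hlev : ∀ (u : ι) (e : ℕ), levR cS ρ u + swCount cS pS o (Script.snoc s i z) u + e =
          levR cS ρ u + swCount cS pS o s u + e := by
        intro u e; rw [hswc]; simp [hoz]
      have hB0 : 0 ≤ N v (levR cS ρ v + swCount cS pS o s v + 1) *
          ((c * Γ) ^ k * ∏ m : Fin k, N (s.y m.succ) (levR cS ρ (s.y m.succ) +
            swCount cS pS o s (s.y m.succ) + if o (s.y m.succ) then 1 else 0)) :=
        mul_nonneg (hN0 _ _) (mul_nonneg (pow_nonneg (mul_nonneg (by exact_mod_cast c.zero_le) hΓ) _)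
          (prod_nonneg fun m _ => hN0 _ _))
      have hΓc : Γ ≤ c * Γ := by
        have : (1 : ℝ) ≤ c := by exact_mod_cast hc
        nlinarith
      calc ∑ x' ∈ univ.filter (fun x : S → Λ => x τ₀ = a ∧ ∀ τ, cS τ ∉ Q → x τ = 0),
            ((∏ u ∈ Q, restrictK cS sec ρ K u x') *
                ∏ m : Fin k, h (s.y m.succ) (x' (pS (s.y m.succ))) (x' (eS (s.y m.succ)))) *
              ∑ y ∈ univ.filter (fun y : S → Λ => ∀ τ, cS τ ≠ z → y τ = 0),
                restrictK cS sec ρ K z y * h z (x' (pS z)) (y (eS z))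
          ≤ ∑ x' ∈ univ.filter (fun x : S → Λ => x τ₀ = a ∧ ∀ τ, cS τ ∉ Q → x τ = 0),
              ((∏ u ∈ Q, restrictK cS sec ρ K u x') *
                  ∏ m : Fin k, h (s.y m.succ) (x' (pS (s.y m.succ))) (x' (eS (s.y m.succ)))) *
                (Γ * N z (levR cS ρ z + 1)) :=
            sum_le_sum fun x' _ => mul_le_mul_of_nonneg_left (hinner x') (hR0 ρ x')
        _ ≤ N v (levR cS ρ v + swCount cS pS o s v + 1) *
              ((c * Γ) ^ k * ∏ m : Fin k, N (s.y m.succ) (levR cS ρ (s.y m.succ) +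
                swCount cS pS o s (s.y m.succ) + if o (s.y m.succ) then 1 else 0)) * (Γ * N z (levR cS ρ z + 1)) := by
            rw [← sum_mul]
            exact mul_le_mul_of_nonneg_right hIH (mul_nonneg hΓ (hN0 _ _))
        _ ≤ N v (levR cS ρ v + swCount cS pS o s v + 1) *
              ((c * Γ) ^ k * ∏ m : Fin k, N (s.y m.succ) (levR cS ρ (s.y m.succ) +
                swCount cS pS o s (s.y m.succ) + if o (s.y m.succ) then 1 else 0)) *
              ((c * Γ) * N z (levR cS ρ z + 1)) :=
            mul_le_mul_of_nonneg_left (mul_le_mul_of_nonneg_right hΓc (hN0 _ _)) hB0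
        _ = N v (levR cS ρ v + swCount cS pS o (Script.snoc s i z) v + 1) *
              ((c * Γ) ^ k * (c * Γ) * ((∏ m : Fin k, N (s.y m.succ) (levR cS ρ (s.y m.succ) +
                swCount cS pS o (Script.snoc s i z) (s.y m.succ) + if o (s.y m.succ) then 1 else 0)) *
                N z (levR cS ρ z + swCount cS pS o (Script.snoc s i z) z + if true then 1 else 0))) := by
            have hz1 : levR cS ρ z + swCount cS pS o (Script.snoc s i z) z + (if true then 1 else 0) =
                levR cS ρ z + 1 := by rw [hswc, hswz]; simp [hoz]
            rw [hz1]
            simp only [hlev]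
            ring

end Oriented

section ScriptParent

/-- **The parent index of a point of a script**: the point `y (m+1)` was attached (by the line `ℓ_{m+1}`) to the point
`y (s.pa m)`, an earlier point. [cite: BenfattoGiulianiMastropietro2006, §2.4 (trees of the expansion)] -/
def Script.pa : {k : ℕ} → Script v k → Fin k → Fin (k + 1)
  | _, Script.nil => Fin.elim0
  | _, Script.snoc s i _ => fun m => Fin.lastCases i.castSucc (fun m' => (Script.pa s m').castSucc) m

/-- The parent of the new point of `snoc s i z` is `y i`. [cite: BenfattoGiulianiMastropietro2006, §2.4] -/
@[simp] theorem Script.pa_snoc_last {k : ℕ} (s : Script v k) (i : Fin (k + 1)) (z : ι) :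
    (Script.snoc s i z).pa (Fin.last k) = i.castSucc := by
  simp [Script.pa]

/-- The parents of the old points of `snoc s i z` are those of `s`. [cite: BenfattoGiulianiMastropietro2006, §2.4] -/
@[simp] theorem Script.pa_snoc_castSucc {k : ℕ} (s : Script v k) (i : Fin (k + 1)) (z : ι) (m : Fin k) :
    (Script.snoc s i z).pa m.castSucc = (s.pa m).castSucc := by
  simp [Script.pa]

/-- The parent of `y (m+1)` has index `≤ m`. [cite: BenfattoGiulianiMastropietro2006, §2.4] -/
theorem Script.pa_le : ∀ {k : ℕ} (s : Script v k) (m : Fin k), ((s.pa m : Fin (k + 1)) : ℕ) ≤ (m : ℕ)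
  | _, Script.nil, m => m.elim0
  | k + 1, Script.snoc s i z, m => by
    induction m using Fin.lastCases with
    | last => rw [Script.pa_snoc_last, Fin.val_castSucc, Fin.val_last]; exact Nat.le_of_lt_succ i.isLt
    | cast m' => rw [Script.pa_snoc_castSucc, Fin.val_castSucc, Fin.val_castSucc]; exact Script.pa_le s m'

/-- **The lines of a script, indexed**: `ℓ_{m+1} = {y (pa m), y (m+1)}`. [cite: BenfattoGiulianiMastropietro2006, §2.4] -/
theorem Script.lines_eq_ofFn : ∀ {k : ℕ} (s : Script v k), s.lines = List.ofFn fun m : Fin k => s(s.y (s.pa m), s.y m.succ)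
  | _, Script.nil => by simp [Script.lines]
  | k + 1, Script.snoc s i z => by
    rw [Script.lines, Script.lines_eq_ofFn s, List.ofFn_succ', List.concat_eq_append]
    congr 1
    · refine List.ofFn_inj.2 (funext fun m => ?_)
      rw [Script.pa_snoc_castSucc, Script.y_snoc_castSucc, Fin.succ_castSucc, Script.y_snoc_castSucc]
    · rw [Script.pa_snoc_last, Script.y_snoc_castSucc, Fin.succ_last, Script.y_snoc_last]

end ScriptParent

end BattleFederbush

end Literature.Probability.LatticeModels
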